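import Literature.NumberTheory.Automorphic.NewformAdelisation
import Literature.NumberTheory.Automorphic.Sweep1SymmetricPowerAdelic
import HarnessLib

/-!
# Adelisation of classical modular forms, II: the lift `φ_f` on `GL₂(𝔸_ℚ) ⧸ A_G GL₂(ℚ)`

Topic `NumberTheory/Automorphic`; layer E-II of the discharge plan of
`Literature.NumberTheory.Automorphic.Gelbart1975_exists_adelicNewform` (`Sweep1SymmetricPowerAdelic`, lang.S24), continuing
`NewformAdelisation` (the archimedean lift `archLift` and
`GL₂(𝔸_ℚ) = GL₂(ℚ) (GL₂(ℝ)⁺ × K₁(N))`, `GL₂(ℚ) ∩ (GL₂(ℝ)⁺ × K₁(N)) = Γ₁(N)`).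

Following Gelbart (1975), §3.A, (3.4)–(3.5), Prop. 3.1 and Bump (1997), §3.6, (6.1)–(6.4), we
**define** the adelisation of a weight-`k` function `f` on `ℍ` invariant under `Γ₁(N)`:

* `adelicLiftFun N k f : GL₂(𝔸_ℚ) → ℂ`, `φ_f(γ h) = archLift k f h_∞` for `γ ∈ GL₂(ℚ)`,
  `h ∈ GL₂(ℝ)⁺ × K₁(N)` — well defined (`adelicLiftFun_eq_archLift`), left `GL₂(ℚ)`-invariant
  (`adelicLiftFun_ofGlobal_mul`), right `{1} × K₁(N)`- and `K(N)`-invariant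
  (`adelicLiftFun_mul_of_archGL_eq_one`, `adelicLiftFun_mul_of_mem_principalCongruenceLevel`),
  invariant under the centre `A_G = ℝ_{>0}` (`adelicLiftFun_posRealScalar_mul`), equal to
  `archLift k f` on `GL₂(ℝ)⁺` (`adelicLiftFun_ofRealGL`), continuous (`continuous_adelicLiftFun`)
  and, for cusp forms, bounded (`exists_bound_adelicLiftFun`);
* `adelicLift N k f : GL₂(𝔸_ℚ) ⧸ A_G GL₂(ℚ) → ℂ`, `[x] ↦ φ_f(x⁻¹)`, its descent to the trunk's
  automorphic quotient (left cosets; the dictionary `F(h) = ψ(h⁻¹ ·)` of `GLnCuspidalSpectrum`),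
  continuous, bounded, in every `ℒᵖ(μ)` for finite `μ` (`memLp_adelicLift`), `K(N)`-invariant
  (`adelicLift_smul_of_mem_principalCongruenceLevel`), non-zero for `f ≠ 0` (`adelicLift_ne_zero`,
  `toLp_adelicLift_ne_zero`), and whose `L²`-class is a `K(N)`-fixed vector of the regular
  representation (`toLp_adelicLift_mem_fixedVectors`).

All of this is proved. What remains of Gelbart's Prop. 3.1 / Lemma 3.7 is isolated as two named
facts about the *defined* object: cuspidality `adelicLift_constantTermVanishes` (Prop. 3.1 (vii))
and the Hecke eigenvalues `adelicLift_heckeEigenvalues` (Lemma 3.7; Bump p. 342). From them we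
prove `Literature.NumberTheory.Automorphic.Gelbart1975_exists_adelicNewform` (`Gelbart1975_exists_adelicNewform_of_adelicLift`)
and hence, with the two trunk facts (Borel–Harish-Chandra, Gelfand–Graev–Piatetski-Shapiro) and
Newton–Thorne's Thm. A, lang.S24 (`exists_cuspidal_symmetricPower_of_adelicLift`).

## Conventions

Types: statements about `φ_f` on the group are made on `GL (Fin 2) (AdeleRing (𝓞 ℚ) ℚ)` (so that
Mathlib's `GL₂` API applies syntactically); the quotient, its action and the regular
representation are the trunk's, on `(AdelicGroupData.gl 2 ℚ).Adelic` (definitionally the same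
type), and the bridging statements (`adelicLift_toAutomorphicQuotient`,
`adelicLift_smul_of_mem_principalCongruenceLevel`) take their group variables in that type.
`φ_f` here is Bump's `φ` with `λ = 1` on `K₁(N)` ((6.3)); Gelbart's (3.4) with `ψ(k₀)` realises,
for `χ ≠ 1`, the conjugate system (module docstring of `Sweep1SymmetricPowerAdelic`), which is why
the Hecke fact is stated with `χ(p)` (Bump (6.4)) — see its docstring.

## References

* S. Gelbart, *Automorphic forms on adele groups*, Ann. of Math. Stud. 83 (1975), §3.A, (3.4)–(3.5),
  Prop. 3.1, p. 28; §3.B, (3.15), Lemma 3.7 [Gelbart1975].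
* D. Bump, *Automorphic forms and representations* (1997), §3.6, (6.1)–(6.4), Thm. 3.6.1 and its
  proof, pp. 338–342 [Bump1997].
* F. Diamond, J. Shurman, *A first course in modular forms*, GTM 228 (2005), Prop. 5.2.1, (5.9)
  [DiamondShurman2005].
* J. Newton, J. A. Thorne, *Symmetric power functoriality for holomorphic modular forms, II*,
  Publ. Math. IHÉS 134 (2021), Thm. A [NewtonThorneIHES2021b].
-/

noncomputable section

open Matrix NumberField IsDedekindDomain UpperHalfPlane MeasureTheory
open scoped MatrixGroups ModularForm NNReal

namespace Literature.NumberTheory.Automorphic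

/-! ### The lift `φ_f` on `GL₂(𝔸_ℚ)` -/

section LiftFun

variable (N : ℕ) (k : ℤ)

/-- **The adelic lift `φ_f : GL₂(𝔸_ℚ) → ℂ` of a function `f` on the upper half plane**, level
`N`, weight `k` (Gelbart (1975), (3.4); Bump (1997), (6.3), case `λ = 1` on `K₁(N)`): write
`g = γ h` with `γ ∈ GL₂(ℚ)` and `h ∈ GL₂(ℝ)⁺ × K₁(N)` (`Rat.exists_ofGlobal_inv_mul_mem_plusLevelOne`,
a choice) and put `φ_f(g) = archLift k f h_∞ = f(h_∞ i) (det h_∞)^{k/2} j(h_∞, i)^{-k}`. For `f`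
slash-invariant of weight `k` under `Γ₁(N)` the value does not depend on the choice
(`adelicLiftFun_eq_archLift`), since two choices differ by an element of
`GL₂(ℚ) ∩ (GL₂(ℝ)⁺ × K₁(N)) = Γ₁(N)`. [cite: Gelbart1975, (3.4)] -/
def adelicLiftFun (f : ℍ → ℂ) (g : GL (Fin 2) (AdeleRing (𝓞 ℚ) ℚ)) : ℂ :=
  archLift k f (Rat.archGL 2 ((GLn.ofGlobal 2 ℚ
    (Classical.choose (Rat.exists_ofGlobal_inv_mul_mem_plusLevelOne (Ideal.span {(N : 𝓞 ℚ)}) g)))⁻¹ * g))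

variable {N k}
variable [NeZero N] {F : Type*} [FunLike F ℍ ℂ]

section SlashInvariant

variable [SlashInvariantFormClass F (CongruenceSubgroup.Gamma1 N) k] (f : F)

/-- Two admissible decompositions give the same archimedean lift: if `γ₁⁻¹ g`, `γ₂⁻¹ g` both lie in
`GL₂(ℝ)⁺ × K₁(N)` then `archLift k f (γ₁⁻¹ g)_∞ = archLift k f (γ₂⁻¹ g)_∞`, because
`γ₁⁻¹ γ₂ ∈ GL₂(ℚ) ∩ (GL₂(ℝ)⁺ × K₁(N)) = Γ₁(N)` (`Rat.archGL_ofGlobal_mem_gamma1`) and `archLift k f`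
is `Γ₁(N)`-invariant on the left (Gelbart (1975), (3.4)–(3.5): `φ_f` is well defined). [cite: Gelbart1975, (3.5)] -/
theorem archLift_archGL_eq_of_mem_plusLevelOne {g : GL (Fin 2) (AdeleRing (𝓞 ℚ) ℚ)} {γ₁ γ₂ : GL (Fin 2) ℚ}
    (h₁ : (GLn.ofGlobal 2 ℚ γ₁)⁻¹ * g ∈ Rat.plusLevelOne (Ideal.span {(N : 𝓞 ℚ)}))
    (h₂ : (GLn.ofGlobal 2 ℚ γ₂)⁻¹ * g ∈ Rat.plusLevelOne (Ideal.span {(N : 𝓞 ℚ)})) :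
    archLift k f (Rat.archGL 2 ((GLn.ofGlobal 2 ℚ γ₁)⁻¹ * g)) =
      archLift k f (Rat.archGL 2 ((GLn.ofGlobal 2 ℚ γ₂)⁻¹ * g)) := by
  have hδ : GLn.ofGlobal 2 ℚ (γ₁⁻¹ * γ₂) ∈ Rat.plusLevelOne (Ideal.span {(N : 𝓞 ℚ)}) := by
    have : GLn.ofGlobal 2 ℚ (γ₁⁻¹ * γ₂) = ((GLn.ofGlobal 2 ℚ γ₁)⁻¹ * g) * ((GLn.ofGlobal 2 ℚ γ₂)⁻¹ * g)⁻¹ := by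
      rw [map_mul, map_inv]; group
    rw [this]
    exact mul_mem h₁ (inv_mem h₂)
  have hmem := Rat.archGL_ofGlobal_mem_gamma1 hδ
  have heq : (GLn.ofGlobal 2 ℚ γ₁)⁻¹ * g = GLn.ofGlobal 2 ℚ (γ₁⁻¹ * γ₂) * ((GLn.ofGlobal 2 ℚ γ₂)⁻¹ * g) := by
    rw [map_mul, map_inv]; group
  rw [heq, map_mul, archLift_mul_of_mem k f hmem]

/-- **`φ_f` is well defined** (Gelbart (1975), (3.4)–(3.5)): for every `γ ∈ GL₂(ℚ)` with
`γ⁻¹ g ∈ GL₂(ℝ)⁺ × K₁(N)`, `φ_f(g) = archLift k f (γ⁻¹ g)_∞`. [cite: Gelbart1975, (3.4)] -/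
theorem adelicLiftFun_eq_archLift {g : GL (Fin 2) (AdeleRing (𝓞 ℚ) ℚ)} {γ : GL (Fin 2) ℚ}
    (hγ : (GLn.ofGlobal 2 ℚ γ)⁻¹ * g ∈ Rat.plusLevelOne (Ideal.span {(N : 𝓞 ℚ)})) :
    adelicLiftFun N k f g = archLift k f (Rat.archGL 2 ((GLn.ofGlobal 2 ℚ γ)⁻¹ * g)) :=
  archLift_archGL_eq_of_mem_plusLevelOne f
    (Classical.choose_spec (Rat.exists_ofGlobal_inv_mul_mem_plusLevelOne (Ideal.span {(N : 𝓞 ℚ)}) g)) hγ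

/-- On `GL₂(ℝ)⁺ × K₁(N)` itself, `φ_f(g) = archLift k f g_∞` (`γ = 1`). [cite: Gelbart1975, (3.4)] -/
theorem adelicLiftFun_eq_archLift_of_mem {g : GL (Fin 2) (AdeleRing (𝓞 ℚ) ℚ)}
    (hg : g ∈ Rat.plusLevelOne (Ideal.span {(N : 𝓞 ℚ)})) :
    adelicLiftFun N k f g = archLift k f (Rat.archGL 2 g) := by
  have h1 : (GLn.ofGlobal 2 ℚ 1)⁻¹ * g ∈ Rat.plusLevelOne (Ideal.span {(N : 𝓞 ℚ)}) := by
    rwa [map_one, inv_one, one_mul]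
  rw [adelicLiftFun_eq_archLift f h1, map_one, inv_one, one_mul]

/-- `φ_f((g_∞, 1)) = archLift k f g_∞` for `det g_∞ > 0`: on `GL₂(ℝ)⁺ ⊆ GL₂(𝔸_ℚ)` the adelic
lift is the archimedean lift (Gelbart (1975), (3.4); Bump (1997), (6.3)). [cite: Gelbart1975, (3.4)] -/
theorem adelicLiftFun_ofRealGL {g : GL (Fin 2) ℝ} (hg : 0 < g.det.val) :
    adelicLiftFun N k f (Rat.ofRealGL 2 g) = archLift k f g := by
  rw [adelicLiftFun_eq_archLift_of_mem f (Rat.ofRealGL_mem_plusLevelOne_iff.2 hg), Rat.archGL_ofRealGL]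

/-- **Left `GL₂(ℚ)`-invariance**: `φ_f(γ g) = φ_f(g)` (Gelbart (1975), Prop. 3.1 (i)). [cite: Gelbart1975, Prop. 3.1] -/
theorem adelicLiftFun_ofGlobal_mul (γ : GL (Fin 2) ℚ) (g : GL (Fin 2) (AdeleRing (𝓞 ℚ) ℚ)) :
    adelicLiftFun N k f (GLn.ofGlobal 2 ℚ γ * g) = adelicLiftFun N k f g := by
  obtain ⟨γ₁, h₁⟩ := Rat.exists_ofGlobal_inv_mul_mem_plusLevelOne (Ideal.span {(N : 𝓞 ℚ)}) g
  have heq : (GLn.ofGlobal 2 ℚ (γ * γ₁))⁻¹ * (GLn.ofGlobal 2 ℚ γ * g) = (GLn.ofGlobal 2 ℚ γ₁)⁻¹ * g := by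
    rw [map_mul]; group
  have h₂ : (GLn.ofGlobal 2 ℚ (γ * γ₁))⁻¹ * (GLn.ofGlobal 2 ℚ γ * g) ∈ Rat.plusLevelOne (Ideal.span {(N : 𝓞 ℚ)}) := by
    rw [heq]; exact h₁
  rw [adelicLiftFun_eq_archLift f h₂, adelicLiftFun_eq_archLift f h₁, heq]

/-- **Right invariance under `{1} × K₁(N)`**: `φ_f(g u) = φ_f(g)` for `u` with trivial archimedean
part and finite part in `K₁(N)` (Gelbart (1975), Prop. 3.1 (ii) with `ψ = 1` on `K₁(N)`; Bump
(1997), (6.3), `λ = 1` on `K₁(N)`). [cite: Gelbart1975, Prop. 3.1] -/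
theorem adelicLiftFun_mul_of_archGL_eq_one {u : GL (Fin 2) (AdeleRing (𝓞 ℚ) ℚ)} (hu : Rat.archGL 2 u = 1)
    (hu' : GLn.sndHom 2 ℚ u ∈ gammaOneFiniteLevel ℚ (Ideal.span {(N : 𝓞 ℚ)}))
    (g : GL (Fin 2) (AdeleRing (𝓞 ℚ) ℚ)) :
    adelicLiftFun N k f (g * u) = adelicLiftFun N k f g := by
  obtain ⟨γ₁, h₁⟩ := Rat.exists_ofGlobal_inv_mul_mem_plusLevelOne (Ideal.span {(N : 𝓞 ℚ)}) g
  have hu1 : u ∈ Rat.plusLevelOne (Ideal.span {(N : 𝓞 ℚ)}) := by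
    rw [Rat.mem_plusLevelOne_iff, hu, map_one, Units.val_one]
    exact ⟨one_pos, hu'⟩
  have h₂ : (GLn.ofGlobal 2 ℚ γ₁)⁻¹ * (g * u) ∈ Rat.plusLevelOne (Ideal.span {(N : 𝓞 ℚ)}) := by
    rw [← mul_assoc]
    exact mul_mem h₁ hu1
  rw [adelicLiftFun_eq_archLift f h₂, adelicLiftFun_eq_archLift f h₁, ← mul_assoc, map_mul, hu, mul_one]

/-- **Right invariance under the principal congruence subgroup `K(N)`** of the trunk
(`principalCongruenceLevel 2 ℚ (N)`, trivial at infinity, `⊆ {1} × K₁(N)`). [cite: Gelbart1975, Prop. 3.1] -/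
theorem adelicLiftFun_mul_of_mem_principalCongruenceLevel {u : GL (Fin 2) (AdeleRing (𝓞 ℚ) ℚ)}
    (hu : u ∈ principalCongruenceLevel 2 ℚ (Ideal.span {(N : 𝓞 ℚ)})) (g : GL (Fin 2) (AdeleRing (𝓞 ℚ) ℚ)) :
    adelicLiftFun N k f (g * u) = adelicLiftFun N k f g :=
  adelicLiftFun_mul_of_archGL_eq_one f
    (Rat.archGL_eq_one_of_mem_glIntegralLevel (principalCongruenceLevel_le 2 ℚ _ hu))
    (Rat.sndHom_mem_gammaOneFiniteLevel_of_mem_principalCongruenceLevel hu) g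

/-- **Invariance under the centre `A_G = ℝ_{>0}`**: `φ_f(z g) = φ_f(g)` for the positive real
scalars `z = posRealScalar 2 ℚ t` (Gelbart (1975), Prop. 3.1 (v) with `ψ|ℝ₊ = 1`; this is
`archLift_realScalarGL_mul`). [cite: Gelbart1975, Prop. 3.1] -/
theorem adelicLiftFun_posRealScalar_mul (t : ℝ≥0ˣ) (g : GL (Fin 2) (AdeleRing (𝓞 ℚ) ℚ)) :
    adelicLiftFun N k f (posRealScalar 2 ℚ t * g) = adelicLiftFun N k f g := by
  obtain ⟨γ₁, h₁⟩ := Rat.exists_ofGlobal_inv_mul_mem_plusLevelOne (Ideal.span {(N : 𝓞 ℚ)}) g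
  have hcomm : (GLn.ofGlobal 2 ℚ γ₁)⁻¹ * (posRealScalar 2 ℚ t * g) =
      posRealScalar 2 ℚ t * ((GLn.ofGlobal 2 ℚ γ₁)⁻¹ * g) := by
    have hc := Subgroup.mem_center_iff.1 (posRealScalar_mem_center 2 ℚ t) (GLn.ofGlobal 2 ℚ γ₁)⁻¹
    rw [← mul_assoc, hc, mul_assoc]
  have h₂ : (GLn.ofGlobal 2 ℚ γ₁)⁻¹ * (posRealScalar 2 ℚ t * g) ∈ Rat.plusLevelOne (Ideal.span {(N : 𝓞 ℚ)}) := by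
    rw [hcomm]
    exact mul_mem (Rat.posRealScalar_mem_plusLevelOne _ t) h₁
  rw [adelicLiftFun_eq_archLift f h₂, adelicLiftFun_eq_archLift f h₁, hcomm, map_mul,
    Rat.archGL_posRealScalar_two, archLift_realScalarGL_mul k f _ (Rat.mem_plusLevelOne_iff.1 h₁).1]

/-- **Invariance under `A_G · GL₂(ℚ)`**, the subgroup of the trunk's automorphic quotient
`GL₂(𝔸_ℚ) ⧸ A_G GL₂(ℚ)` (`AdelicGroupData.quotientSubgroup`): `φ_f(h g) = φ_f(g)` for
`h ∈ A_G ⊔ GL₂(ℚ)` (both generators leave `φ_f` invariant, and the invariance group is a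
subgroup). [cite: Gelbart1975, Prop. 3.1] -/
theorem adelicLiftFun_mul_of_mem_quotientSubgroup {h : GL (Fin 2) (AdeleRing (𝓞 ℚ) ℚ)}
    (hh : h ∈ (AdelicGroupData.gl 2 ℚ).quotientSubgroup) (g : GL (Fin 2) (AdeleRing (𝓞 ℚ) ℚ)) :
    adelicLiftFun N k f (h * g) = adelicLiftFun N k f g := by
  -- the subgroup of `h` leaving `φ_f` invariant
  let S : Subgroup (GL (Fin 2) (AdeleRing (𝓞 ℚ) ℚ)) :=
    { carrier := {h | ∀ g, adelicLiftFun N k f (h * g) = adelicLiftFun N k f g}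
      one_mem' := fun g => by rw [one_mul]
      mul_mem' := fun {a b} ha hb g => by rw [mul_assoc, ha, hb]
      inv_mem' := fun {a} ha g => by rw [← ha (a⁻¹ * g), mul_inv_cancel_left] }
  have hle : (AdelicGroupData.gl 2 ℚ).quotientSubgroup ≤ S := by
    refine sup_le ?_ ?_
    · rintro _ ⟨t, rfl⟩ g
      exact adelicLiftFun_posRealScalar_mul f t g
    · rintro _ ⟨γ, rfl⟩ g
      exact adelicLiftFun_ofGlobal_mul f γ g
  exact hle hh g

/-- `φ_f(a⁻¹) = φ_f(b⁻¹)` when `a⁻¹ b ∈ A_G GL₂(ℚ)`, i.e. `g ↦ φ_f(g⁻¹)` is constant on the left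
cosets of `A_G GL₂(ℚ)` (the descent datum for `adelicLift`). [cite: Gelbart1975, Prop. 3.1] -/
theorem adelicLiftFun_inv_eq_of_inv_mul_mem {a b : GL (Fin 2) (AdeleRing (𝓞 ℚ) ℚ)}
    (h : a⁻¹ * b ∈ (AdelicGroupData.gl 2 ℚ).quotientSubgroup) :
    adelicLiftFun N k f a⁻¹ = adelicLiftFun N k f b⁻¹ := by
  have e : b⁻¹ = (a⁻¹ * b)⁻¹ * a⁻¹ := by group
  rw [e]
  exact (adelicLiftFun_mul_of_mem_quotientSubgroup f (inv_mem h) a⁻¹).symm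

/-- `φ_f((u x)⁻¹) = φ_f(x⁻¹)` for `u ∈ K(N)`. [cite: Gelbart1975, Prop. 3.1] -/
theorem adelicLiftFun_mul_inv_of_mem_principalCongruenceLevel {u : GL (Fin 2) (AdeleRing (𝓞 ℚ) ℚ)}
    (hu : u ∈ principalCongruenceLevel 2 ℚ (Ideal.span {(N : 𝓞 ℚ)})) (x : GL (Fin 2) (AdeleRing (𝓞 ℚ) ℚ)) :
    adelicLiftFun N k f (u * x)⁻¹ = adelicLiftFun N k f x⁻¹ := by
  rw [_root_.mul_inv_rev]
  exact adelicLiftFun_mul_of_mem_principalCongruenceLevel f (inv_mem hu) _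

end SlashInvariant

end LiftFun

/-! ### Descent to the automorphic quotient `GL₂(𝔸_ℚ) ⧸ A_G GL₂(ℚ)` -/

section Lift

variable (N : ℕ) (k : ℤ) [NeZero N] {F : Type*} [FunLike F ℍ ℂ]
  [SlashInvariantFormClass F (CongruenceSubgroup.Gamma1 N) k]

/-- **The adelic lift `φ_f` on the automorphic quotient** `GL₂(𝔸_ℚ) ⧸ A_G GL₂(ℚ)` of the trunk
(left cosets `x A_G GL₂(ℚ)`, outline D10), for `f` of weight `k` invariant under `Γ₁(N)`:
`adelicLift N k f (x A_G GL₂(ℚ)) = φ_f(x⁻¹)` (`adelicLiftFun`), well defined because `φ_f` is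
left-invariant under `A_G GL₂(ℚ)` (`adelicLiftFun_mul_of_mem_quotientSubgroup`). Under the
dictionary `F(h) = ψ(h⁻¹ ·)` between functions `ψ` on the left quotient and classical automorphic
forms `F` on `GL₂(ℚ) A_G \ GL₂(𝔸_ℚ)` (module docstrings of `GLnCuspidalSpectrum`, `AutomorphicTwist`)
this is exactly Gelbart's `φ_f` / Bump's `φ` (Gelbart (1975), (3.4); Bump (1997), (6.3)), and the
regular representation `(R(y) ψ)(x) = ψ(y⁻¹ x)` of the trunk is right translation of `φ_f`. [cite: Gelbart1975, (3.4)] -/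
def adelicLift (f : F) : (AdelicGroupData.gl 2 ℚ).automorphicQuotient → ℂ :=
  Quotient.lift
    (fun x : (AdelicGroupData.gl 2 ℚ).Adelic => adelicLiftFun N k f (x⁻¹ : GL (Fin 2) (AdeleRing (𝓞 ℚ) ℚ)))
    fun _ _ hab => adelicLiftFun_inv_eq_of_inv_mul_mem f (QuotientGroup.leftRel_apply.mp hab)

variable {N k}
variable (f : F)

/-- `adelicLift N k f [x] = φ_f(x⁻¹)` (definitional). [cite: Gelbart1975, (3.4)] -/
@[simp]
theorem adelicLift_toAutomorphicQuotient (x : (AdelicGroupData.gl 2 ℚ).Adelic) :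
    adelicLift N k f ((AdelicGroupData.gl 2 ℚ).toAutomorphicQuotient x) =
      adelicLiftFun N k f (x⁻¹ : GL (Fin 2) (AdeleRing (𝓞 ℚ) ℚ)) :=
  rfl

/-- **`K(N)`-invariance on the quotient**: `adelicLift N k f (u • x) = adelicLift N k f x` for
`u` in the principal congruence subgroup `K(N)` (`u • [x] = [u x]` and `φ_f((ux)⁻¹) = φ_f(x⁻¹ u⁻¹)
= φ_f(x⁻¹)`). [cite: Gelbart1975, Prop. 3.1] -/
theorem adelicLift_smul_of_mem_principalCongruenceLevel {u : (AdelicGroupData.gl 2 ℚ).Adelic}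
    (hu : (u : GL (Fin 2) (AdeleRing (𝓞 ℚ) ℚ)) ∈ principalCongruenceLevel 2 ℚ (Ideal.span {(N : 𝓞 ℚ)}))
    (x : (AdelicGroupData.gl 2 ℚ).automorphicQuotient) :
    adelicLift N k f (u • x) = adelicLift N k f x := by
  induction x using QuotientGroup.induction_on with
  | H x =>
    change adelicLift N k f ((AdelicGroupData.gl 2 ℚ).toAutomorphicQuotient (u * x)) =
      adelicLift N k f ((AdelicGroupData.gl 2 ℚ).toAutomorphicQuotient x)
    exact adelicLiftFun_mul_inv_of_mem_principalCongruenceLevel f hu x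

end Lift

/-! ### Analytic properties: continuity, boundedness, square-integrability, non-vanishing -/

section Analytic

variable {N : ℕ} {k : ℤ} [NeZero N] {F : Type*} [FunLike F ℍ ℂ]

section SlashInvariant

variable [SlashInvariantFormClass F (CongruenceSubgroup.Gamma1 N) k] (f : F)

/-- **Continuity of `φ_f` on `GL₂(𝔸_ℚ)`** for continuous `f`: near `g₀ = γ h₀` the open set
`γ (GL₂(ℝ)⁺ × K₁(N))` is a neighbourhood on which `φ_f(g) = archLift k f (γ⁻¹ g)_∞`
(`adelicLiftFun_eq_archLift`), a continuous function of `g` (`continuousOn_archLift`,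
`Rat.continuous_archGL`); Gelbart (1975), Prop. 3.1 (`φ_f` is continuous, indeed smooth). [cite: Gelbart1975, Prop. 3.1] -/
theorem continuous_adelicLiftFun (hf : Continuous f) : Continuous (adelicLiftFun N k f) := by
  refine continuous_iff_continuousAt.2 fun g₀ => ?_
  obtain ⟨γ, hγ⟩ := Rat.exists_ofGlobal_inv_mul_mem_plusLevelOne (Ideal.span {(N : 𝓞 ℚ)}) g₀
  set U : Set (GL (Fin 2) (AdeleRing (𝓞 ℚ) ℚ)) :=
    {g | (GLn.ofGlobal 2 ℚ γ)⁻¹ * g ∈ Rat.plusLevelOne (Ideal.span {(N : 𝓞 ℚ)})} with hU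
  have hUo : IsOpen U := (Rat.isOpen_plusLevelOne _).preimage (continuous_const_mul _)
  have hcont : ContinuousOn (adelicLiftFun N k f) U := by
    have h1 : ContinuousOn (fun g => archLift k f (Rat.archGL 2 ((GLn.ofGlobal 2 ℚ γ)⁻¹ * g))) U := by
      refine (continuousOn_archLift k hf).comp
        ((Rat.continuous_archGL 2).comp (continuous_const_mul _)).continuousOn fun g hg => ?_
      exact (Rat.mem_plusLevelOne_iff.1 hg).1
    exact h1.congr fun g hg => adelicLiftFun_eq_archLift f hg
  exact hcont.continuousAt (hUo.mem_nhds hγ)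

/-- **Continuity of `φ_f` on the automorphic quotient** (the quotient map is open and
`x ↦ φ_f(x⁻¹)` is continuous). [cite: Gelbart1975, Prop. 3.1] -/
theorem continuous_adelicLift (hf : Continuous f) : Continuous (adelicLift N k f) := by
  have h : Continuous fun x : GL (Fin 2) (AdeleRing (𝓞 ℚ) ℚ) => adelicLiftFun N k f x⁻¹ :=
    (continuous_adelicLiftFun f hf).comp continuous_inv
  exact continuous_quot_lift _ h

/-- The element `(y x; 0 1) ∈ GL₂(ℝ)⁺` moving `i` to `τ = x + iy`. [folklore] -/
def upperHalfPlaneToGL (τ : ℍ) : GL (Fin 2) ℝ :=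
  Matrix.GeneralLinearGroup.mkOfDetNeZero !![τ.im, τ.re; 0, 1]
    (by rw [Matrix.det_fin_two_of]; simpa using τ.im_ne_zero)

/-- `det (y x; 0 1) = y > 0`. [folklore] -/
theorem det_upperHalfPlaneToGL (τ : ℍ) : (upperHalfPlaneToGL τ).det.val = τ.im := by
  rw [Matrix.GeneralLinearGroup.val_det_apply]
  change Matrix.det !![τ.im, τ.re; 0, 1] = τ.im
  rw [Matrix.det_fin_two_of]; ring

/-- `(y x; 0 1) • i = x + iy`: `GL₂(ℝ)⁺` acts transitively on `ℍ`. [folklore] -/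
theorem upperHalfPlaneToGL_smul_I (τ : ℍ) : upperHalfPlaneToGL τ • UpperHalfPlane.I = τ := by
  have hdet : 0 < (upperHalfPlaneToGL τ).det.val := by rw [det_upperHalfPlaneToGL]; exact τ.im_pos
  apply UpperHalfPlane.ext
  rw [UpperHalfPlane.coe_smul_of_det_pos hdet]
  simp only [UpperHalfPlane.num, UpperHalfPlane.denom, upperHalfPlaneToGL,
    Matrix.GeneralLinearGroup.val_mkOfDetNeZero, Matrix.of_apply, Matrix.cons_val', Matrix.cons_val_zero,
    Matrix.cons_val_one, Matrix.empty_val', Matrix.cons_val_fin_one, UpperHalfPlane.coe_I,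
    Complex.ofReal_zero, zero_mul, Complex.ofReal_one, zero_add, div_one]
  apply Complex.ext <;> simp

/-- **`φ_f ≠ 0` if `f ≠ 0`**: at `g = ((y x; 0 1), 1)` with `f(x + iy) ≠ 0`,
`φ_f(g) = archLift k f (y x; 0 1)` has absolute value `|f(x+iy)| y^{k/2} ≠ 0`. [cite: Gelbart1975, (3.4)] -/
theorem exists_adelicLiftFun_ne_zero (hf : ∃ τ : ℍ, f τ ≠ 0) :
    ∃ g : GL (Fin 2) ℝ, 0 < g.det.val ∧ adelicLiftFun N k f (Rat.ofRealGL 2 g) ≠ 0 := by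
  obtain ⟨τ, hτ⟩ := hf
  have hdet : 0 < (upperHalfPlaneToGL τ).det.val := by rw [det_upperHalfPlaneToGL]; exact τ.im_pos
  refine ⟨upperHalfPlaneToGL τ, hdet, ?_⟩
  rw [adelicLiftFun_ofRealGL f hdet, ← norm_ne_zero_iff, norm_archLift_of_det_pos k f hdet,
    upperHalfPlaneToGL_smul_I]
  exact mul_ne_zero (norm_ne_zero_iff.2 hτ) (zpow_ne_zero _ (Real.sqrt_pos.2 τ.im_pos).ne')

/-- **`adelicLift N k f ≠ 0` if `f ≠ 0`.** [cite: Gelbart1975, (3.4)] -/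
theorem adelicLift_ne_zero (hf : ∃ τ : ℍ, f τ ≠ 0) : adelicLift N k f ≠ 0 := by
  obtain ⟨g, -, hg⟩ := exists_adelicLiftFun_ne_zero f hf
  intro h
  have := congrFun h ((AdelicGroupData.gl 2 ℚ).toAutomorphicQuotient
    ((Rat.ofRealGL 2 g)⁻¹ : GL (Fin 2) (AdeleRing (𝓞 ℚ) ℚ)))
  rw [adelicLift_toAutomorphicQuotient, Pi.zero_apply] at this
  exact hg (by simpa using this)

end SlashInvariant

section CuspForm

variable [CuspFormClass F (CongruenceSubgroup.Gamma1 N) k] (f : F)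

/-- **Boundedness of `φ_f` on `GL₂(𝔸_ℚ)`** for a cusp form `f`: `φ_f(g) = archLift k f h_∞` with
`det h_∞ > 0`, bounded by `exists_bound_archLift` (Gelbart (1975), §3.A, p. 28: `φ_f` is
bounded, hence in `L²` of the finite-volume quotient; Bump (1997), §3.6). [cite: Gelbart1975, §3.A, p. 28] -/
theorem exists_bound_adelicLiftFun : ∃ C : ℝ, ∀ g, ‖adelicLiftFun N k f g‖ ≤ C := by
  obtain ⟨C, hC⟩ := exists_bound_archLift (Γ := ((CongruenceSubgroup.Gamma1 N : Subgroup SL(2, ℤ)) :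
    Subgroup (GL (Fin 2) ℝ))) (k := k) f
  refine ⟨C, fun g => ?_⟩
  obtain ⟨γ, hγ⟩ := Rat.exists_ofGlobal_inv_mul_mem_plusLevelOne (Ideal.span {(N : 𝓞 ℚ)}) g
  rw [adelicLiftFun_eq_archLift f hγ]
  exact hC _ (Rat.mem_plusLevelOne_iff.1 hγ).1

/-- Boundedness of `φ_f` on the automorphic quotient. [cite: Gelbart1975, §3.A, p. 28] -/
theorem exists_bound_adelicLift : ∃ C : ℝ, ∀ x, ‖adelicLift N k f x‖ ≤ C := by
  obtain ⟨C, hC⟩ := exists_bound_adelicLiftFun f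
  refine ⟨C, fun x => ?_⟩
  induction x using QuotientGroup.induction_on with
  | H x => exact hC _

/-- **`φ_f ∈ ℒᵖ(GL₂(𝔸_ℚ) ⧸ A_G GL₂(ℚ), μ)`** for every finite measure `μ` and every `p`
(continuous and bounded; Gelbart (1975), p. 28: `φ_f ∈ L²(G_ℚ \\ G_𝔸)`; Bump (1997), §3.6:
`φ ∈ L²(GL₂(ℚ) \\ GL₂(𝔸), ω)`). [cite: Gelbart1975, Prop. 3.1, p. 28] -/
theorem memLp_adelicLift (μ : Measure (AdelicGroupData.gl 2 ℚ).automorphicQuotient) [IsFiniteMeasure μ]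
    (p : ENNReal) : MemLp (adelicLift N k f) p μ := by
  obtain ⟨C, hC⟩ := exists_bound_adelicLift f
  exact MemLp.of_bound (continuous_adelicLift f
    (ModularFormClass.continuous (Γ := CongruenceSubgroup.Gamma1 N) (k := k) f)).aestronglyMeasurable C
    (Filter.Eventually.of_forall hC)

/-- **The `L²`-class of `φ_f` is non-zero** for `f ≠ 0` and `μ` positive on open sets
(`φ_f` is continuous and not identically zero). [cite: Gelbart1975, (3.4)] -/
theorem toLp_adelicLift_ne_zero (μ : Measure (AdelicGroupData.gl 2 ℚ).automorphicQuotient)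
    [IsFiniteMeasure μ] [μ.IsOpenPosMeasure] (hf : ∃ τ : ℍ, f τ ≠ 0) :
    (memLp_adelicLift f μ 2).toLp (adelicLift N k f) ≠ 0 := by
  intro h
  have h0 : MemLp (0 : (AdelicGroupData.gl 2 ℚ).automorphicQuotient → ℂ) 2 μ := MemLp.zero
  rw [← MemLp.toLp_zero h0, MemLp.toLp_eq_toLp_iff] at h
  exact adelicLift_ne_zero f hf ((Continuous.ae_eq_iff_eq μ
    (continuous_adelicLift f
    (ModularFormClass.continuous (Γ := CongruenceSubgroup.Gamma1 N) (k := k) f)) continuous_const).1 h)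

end CuspForm

end Analytic

/-! ### The `L²`-vector `φ_f` and its `K(N)`-invariance -/

section L2

variable {N : ℕ} {k : ℤ} [NeZero N] {F : Type*} [FunLike F ℍ ℂ]
  [CuspFormClass F (CongruenceSubgroup.Gamma1 N) k] (f : F)
  (μ : Measure (AdelicGroupData.gl 2 ℚ).automorphicQuotient) [(AdelicGroupData.gl 2 ℚ).IsAutomorphicMeasure μ]

/-- **`φ_f` is a `K(N)`-fixed vector of `L²`**: for every closed subrepresentation `W` of the
regular representation containing the class of `φ_f`, that class lies in `W^{K(N)}`
(`R(u) [φ_f] = [φ_f(u⁻¹ ·)] = [φ_f]`, `adelicLift_smul_of_mem_principalCongruenceLevel`;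
Gelbart (1975), Prop. 3.1 (ii): `φ_f` is right-`K₁(N)`-, a fortiori right-`K(N)`-invariant). [cite: Gelbart1975, Prop. 3.1] -/
theorem toLp_adelicLift_mem_fixedVectors
    (W : ContRepresentation.ClosedSubrep ((AdelicGroupData.gl 2 ℚ).rightRegular μ))
    (hW : (memLp_adelicLift f μ 2).toLp (adelicLift N k f) ∈ W) :
    (⟨_, hW⟩ : W.toSubmodule) ∈ W.fixedVectors (principalCongruenceLevel 2 ℚ (Ideal.span {(N : 𝓞 ℚ)})) := by
  rw [ContRepresentation.ClosedSubrep.mem_fixedVectors]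
  intro u hu
  apply Subtype.ext
  rw [ContRepresentation.ClosedSubrep.coe_toContRep_apply, AdelicGroupData.rightRegular_apply,
    DomMulAct.mk_smul_toLp]
  congr 1
  funext x
  exact adelicLift_smul_of_mem_principalCongruenceLevel f (inv_mem hu) x

end L2

/-! ### The two remaining analytic statements, and the assembly -/

open EllipticCurves.ModularForms Rat.HeightOneSpectrum

section Facts

/-- **Cuspidality of the adelic lift** (Gelbart (1975), Prop. 3.1 (vii): "`φ_f` is cuspidal:
`∫_{ℚ \ 𝔸} φ(n(x) g) dx = 0` for all `g`, because `f` vanishes at every cusp"; Bump (1997), §3.6,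
Thm. 3.6.1, statement that `φ ∈ A₀(GL(2, ℚ) \ GL(2, 𝔸), ω)`). Read on the defined object: for every
level `N ≥ 1`, weight `k` and cusp form `f ∈ S_k(Γ₁(N))`, the function `adelicLift N k f` on
`GL₂(𝔸_ℚ) ⧸ A_G GL₂(ℚ)` has vanishing constant term along the unipotent radical of the Borel
(`ConstantTermVanishes 2 ℚ · 1` of `GLnCuspidalSpectrum`: for every Haar measure on
`N(𝔸_ℚ) ≅ 𝔸_ℚ`, every fundamental domain for `N(ℚ) ≅ ℚ` and every `x`, the integral of
`X ↦ adelicLift N k f (x (1 + X))` over the fundamental domain exists and vanishes). The proof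
(strong approximation to move `x` into `GL₂(ℝ)⁺ × K₁(N)`, unfolding `ℚ \ 𝔸 = (ℝ × MẐ)/Mℤ`, local
constancy in the finite variable, and the vanishing of the zeroth Fourier coefficient of the cusp
form `f ∣ γ` at the cusp `γ ∞`) is not yet in the tree; a named fact, to be discharged in
`NewformAdelisationCuspidal`. [cite: Gelbart1975, Prop. 3.1] [cite: Bump1997, Thm. 3.6.1] -/
def adelicLift_constantTermVanishes : Prop :=
  ∀ (N : ℕ) [NeZero N] (k : ℤ) (f : CuspForm (CongruenceSubgroup.Gamma1 N) k),
    ConstantTermVanishes 2 ℚ (adelicLift N k f) 1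

/-- **Hecke eigenvalues of the adelic lift of a newform** (Gelbart (1975), Lemma 3.7:
`p^{k/2-1} T̃(p) φ_f = φ_{T(p) f}` for `p ∤ N`, `T̃(p)` the operator of the double coset
`K_p diag(p, 1) K_p = ⊔ᵢ yᵢ K_p` ((3.15)); Bump (1997), §3.6, p. 342: the adelisation of a
`T_p`-eigenform of level `N` and character `χ` is an eigenfunction of `𝕋_p` with the eigenvalue
of the classical Hecke operator and of `ℝ_p` with the eigenvalue `χ(p)` ((6.4)); the underlying
coset computation is Diamond–Shurman, Prop. 5.2.1 / (5.9), `Γ₁(N) diag(1,p) Γ₁(N) =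
⊔_{b mod p} Γ₁(N) (1 b; 0 p) ⊔ Γ₁(N) (m n; N p)(p 0; 0 1)`). Read on the defined object and the
trunk's operators (conventions as in `Sweep1SymmetricPowerAdelic`): let `f ∈ S_k(Γ₁(N))` be a
newform (`IsNewform1`; `a_p = heckeEigenvalue f p`, `χ = nebentypus f`), `μ` an automorphic
measure, `W` any closed subrepresentation of `L²(GL₂(𝔸_ℚ) ⧸ A_G GL₂(ℚ), μ)` containing the class
`[φ_f]` of `adelicLift N k f`, and `v = p ∤ N` a finite place. Then for some uniformizer `ϖ` of
`ℚ_p`, **`[K(N) diag(ϖ, 1) K(N)] [φ_f] = p^{1-k/2} a_p [φ_f]`** and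
**`[K(N) diag(ϖ, ϖ) K(N)] [φ_f] = χ(p) [φ_f]`** in `W` (`heckeOperatorAt`, `heckeDiagAt`,
`principalCongruenceLevel 2 ℚ (N)`; the value of the double-coset operator `∑ R(yᵢ)` on `[φ_f]`
does not depend on `W`). Not yet proved on the tree (it needs the local coset decomposition of
`GL₂(ℤ_p) diag(p,1) GL₂(ℤ_p)` transported into `GL₂(𝔸_ℚ)`, the `K₀(N)`-equivariance of `φ_f`
through `χ`, and the comparison with `heckeT`); a named fact, to be discharged in
`NewformAdelisationHecke`. [cite: Gelbart1975, Lemma 3.7] [cite: Bump1997, §3.6, (6.4) and p. 342] -/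
def adelicLift_heckeEigenvalues : Prop :=
  ∀ (N : ℕ) [NeZero N] (k : ℤ) (f : CuspForm (CongruenceSubgroup.Gamma1 N) k) (_ : IsNewform1 f)
    (μ : Measure (AdelicGroupData.gl 2 ℚ).automorphicQuotient) [(AdelicGroupData.gl 2 ℚ).IsAutomorphicMeasure μ]
    (W : ContRepresentation.ClosedSubrep ((AdelicGroupData.gl 2 ℚ).rightRegular μ))
    (hW : (memLp_adelicLift f μ 2).toLp (adelicLift N k f) ∈ W)
    (v : HeightOneSpectrum (𝓞 ℚ)), ¬ v.asIdeal ∣ Ideal.span {(N : 𝓞 ℚ)} →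
      ∃ ϖ : (v.adicCompletion ℚ)ˣ,
        Valued.v (ϖ : v.adicCompletion ℚ) = WithZero.exp (-1 : ℤ) ∧
        heckeOperatorAt W (principalCongruenceLevel 2 ℚ (Ideal.span {(N : 𝓞 ℚ)}))
            (heckeDiagAt 2 ℚ v ϖ 1) ⟨_, hW⟩ =
          (heckeEigenvalue f (primesEquiv v) /
            (((Real.sqrt (primesEquiv v : ℕ) : ℝ) : ℂ) ^ (k - 2))) • ⟨_, hW⟩ ∧
        heckeOperatorAt W (principalCongruenceLevel 2 ℚ (Ideal.span {(N : 𝓞 ℚ)}))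
            (heckeDiagAt 2 ℚ v ϖ 2) ⟨_, hW⟩ =
          (nebentypus f (primesEquiv v : ℕ) : ℂ) • ⟨_, hW⟩

end Facts

section Assembly

variable {N : ℕ} [NeZero N] {k : ℤ}

/-- A normalised form (`a₁(f) = 1`), in particular a newform, is not identically zero (sibling of
`ne_zero_of_isNormalized` in `EllipticCurves/DeligneSerreWeightOneBound`, in the `∃ τ` form and
without that file's imports). [folklore] -/
theorem exists_apply_ne_zero_of_isNormalized {Γ : Subgroup (GL (Fin 2) ℝ)} {f : CuspForm Γ k}
    (hf : IsNormalized f) : ∃ τ : ℍ, f τ ≠ 0 := by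
  by_contra h
  push Not at h
  have h0 : (⇑f : ℍ → ℂ) = 0 := funext h
  rw [IsNormalized, h0, UpperHalfPlane.qExpansion_zero] at hf
  simp at hf

/-- **Under the cuspidality statement, `φ_f` is a continuous square-integrable cusp form** on
`GL₂(𝔸_ℚ) ⧸ A_G GL₂(ℚ)` in the sense of the trunk (`IsContinuousCuspForm 2 ℚ μ`): continuity and
`L²` are proved (`continuous_adelicLift`, `memLp_adelicLift`), and for `n = 2` the only proper
standard parabolic is the Borel (`k = 1`). [cite: Gelbart1975, Prop. 3.1] -/
theorem isContinuousCuspForm_adelicLift (hC : adelicLift_constantTermVanishes)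
    (f : CuspForm (CongruenceSubgroup.Gamma1 N) k)
    (μ : Measure (AdelicGroupData.gl 2 ℚ).automorphicQuotient) [(AdelicGroupData.gl 2 ℚ).IsAutomorphicMeasure μ] :
    IsContinuousCuspForm 2 ℚ μ (adelicLift N k f) := by
  refine ⟨continuous_adelicLift f
    (ModularFormClass.continuous (Γ := CongruenceSubgroup.Gamma1 N) (k := k) f),
    memLp_adelicLift f μ 2, fun k' hk' hk'2 => ?_⟩
  obtain rfl : k' = 1 := by omega
  exact hC N k f

/-- **Discharge of the adelisation statement from the two analytic facts**: the cuspidality of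
`φ_f` (`adelicLift_constantTermVanishes`) and its Hecke eigenvalues (`adelicLift_heckeEigenvalues`)
imply `Literature.NumberTheory.Automorphic.Gelbart1975_exists_adelicNewform` — the witness is the `L²`-class of
`adelicLift N k f` in `L²_cusp` (`mem_cuspidalSubspace_of_isContinuousCuspForm`), which is
`K(N)`-fixed (`toLp_adelicLift_mem_fixedVectors`, proved) and non-zero (`toLp_adelicLift_ne_zero`,
proved; a newform is normalised, hence `≠ 0`). Everything except the two named facts is proved in
`NewformAdelisation` and this file (Gelbart (1975), §3.A; Bump (1997), §3.6). [cite: Gelbart1975, Prop. 3.1 and Lemma 3.7] -/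
theorem Gelbart1975_exists_adelicNewform_of_adelicLift (hC : adelicLift_constantTermVanishes)
    (hH : adelicLift_heckeEigenvalues) :
    Literature.NumberTheory.Automorphic.Gelbart1975_exists_adelicNewform (N := N) (k := k) := by
  intro _hk f hf μ _
  have hcusp := isContinuousCuspForm_adelicLift hC f μ
  have hmem : (memLp_adelicLift f μ 2).toLp (adelicLift N k f) ∈ cuspidalSubspace 2 ℚ μ :=
    mem_cuspidalSubspace_of_isContinuousCuspForm hcusp
  refine ⟨⟨_, hmem⟩, toLp_adelicLift_mem_fixedVectors f μ _ hmem, ?_, fun v hv => hH N k f hf μ _ hmem v hv⟩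
  have hne := toLp_adelicLift_ne_zero f μ (exists_apply_ne_zero_of_isNormalized hf.2.2.2)
  intro h0
  exact hne (congrArg Subtype.val h0)

/-- **Gelbart's dictionary from the two analytic facts and the two trunk facts**
(`Gelbart1975_exists_isAutomorphicRepOf_of_adelicNewform` of `Sweep1SymmetricPowerAdelic` fed with
`Gelbart1975_exists_adelicNewform_of_adelicLift`): cuspidality and Hecke eigenvalues of `φ_f`,
existence of an automorphic measure (Borel–Harish-Chandra) and discrete decomposability of
`L²_cusp` (Gelfand–Graev–Piatetski-Shapiro) give every newform of weight `k ≥ 2` a cuspidal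
automorphic representation with its Satake parameters (Gelbart (1975), Thm. 5.19; Bump (1997),
Thm. 3.6.1). [cite: Bump1997, Thm. 3.6.1] -/
theorem Gelbart1975_exists_isAutomorphicRepOf_of_adelicLift (hC : adelicLift_constantTermVanishes)
    (hH : adelicLift_heckeEigenvalues) (hμ : AdelicGroupData.exists_isAutomorphicMeasure_gl 2 ℚ)
    (hd : ∀ (μ : Measure (AdelicGroupData.gl 2 ℚ).automorphicQuotient)
      [(AdelicGroupData.gl 2 ℚ).IsAutomorphicMeasure μ], GLnCuspidalSpectrum.isDiscretelyDecomposable_cuspidal 2 ℚ μ) :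
    Literature.NumberTheory.Automorphic.Gelbart1975_exists_isAutomorphicRepOf (N := N) (k := k) :=
  Literature.NumberTheory.Automorphic.Gelbart1975_exists_isAutomorphicRepOf_of_adelicNewform
    (Gelbart1975_exists_adelicNewform_of_adelicLift hC hH) hμ hd

/-- **lang.S24 from the two analytic facts, the two trunk facts and Newton–Thorne's Thm. A**
(`exists_cuspidal_symmetricPower_of_adelicNewform` of `Sweep1SymmetricPowerAdelic` fed with
`Gelbart1975_exists_adelicNewform_of_adelicLift`). After this theorem
`Literature.NumberTheory.Automorphic.exists_cuspidal_symmetricPower` rests on: `adelicLift_constantTermVanishes`,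
`adelicLift_heckeEigenvalues` (classical, about the defined `φ_f`), `exists_isAutomorphicMeasure_gl 2 ℚ`,
`isDiscretelyDecomposable_cuspidal 2 ℚ μ` (trunk), and `NewtonThorne2021_exists_cuspidal_symmPowerLift`.
[cite: NewtonThorneIHES2021b, Thm. A] -/
theorem exists_cuspidal_symmetricPower_of_adelicLift (hC : adelicLift_constantTermVanishes)
    (hH : adelicLift_heckeEigenvalues) (hμ : AdelicGroupData.exists_isAutomorphicMeasure_gl 2 ℚ)
    (hd : ∀ (μ : Measure (AdelicGroupData.gl 2 ℚ).automorphicQuotient)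
      [(AdelicGroupData.gl 2 ℚ).IsAutomorphicMeasure μ], GLnCuspidalSpectrum.isDiscretelyDecomposable_cuspidal 2 ℚ μ)
    (hNT : Literature.NumberTheory.Automorphic.NewtonThorne2021_exists_cuspidal_symmPowerLift (N := N) (k := k)) :
    Literature.NumberTheory.Automorphic.exists_cuspidal_symmetricPower (N := N) (k := k) :=
  Literature.NumberTheory.Automorphic.exists_cuspidal_symmetricPower_of_adelicNewform
    (Gelbart1975_exists_adelicNewform_of_adelicLift hC hH) hμ hd hNT

/-- **lang.S24 ⇔ Newton–Thorne's weak-lift statement**, under the two analytic facts and the two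
trunk facts (`exists_cuspidal_symmetricPower_iff_newtonThorne2021_of_adelicNewform`). [cite: NewtonThorneIHES2021b, Thm. A] -/
theorem exists_cuspidal_symmetricPower_iff_newtonThorne2021_of_adelicLift
    (hC : adelicLift_constantTermVanishes) (hH : adelicLift_heckeEigenvalues)
    (hμ : AdelicGroupData.exists_isAutomorphicMeasure_gl 2 ℚ)
    (hd : ∀ (μ : Measure (AdelicGroupData.gl 2 ℚ).automorphicQuotient)
      [(AdelicGroupData.gl 2 ℚ).IsAutomorphicMeasure μ], GLnCuspidalSpectrum.isDiscretelyDecomposable_cuspidal 2 ℚ μ) :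
    Literature.NumberTheory.Automorphic.exists_cuspidal_symmetricPower (N := N) (k := k) ↔
      Literature.NumberTheory.Automorphic.NewtonThorne2021_exists_cuspidal_symmPowerLift (N := N) (k := k) :=
  Literature.NumberTheory.Automorphic.exists_cuspidal_symmetricPower_iff_newtonThorne2021_of_adelicNewform
    (Gelbart1975_exists_adelicNewform_of_adelicLift hC hH) hμ hd

end Assembly

end Literature.NumberTheory.Automorphic
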